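import Literature.Computability.MetaComplexity.UPSearchScheme
import Literature.Computability.MetaComplexity.UPSearchBricks
import Literature.Computability.MetaComplexity.SchemeEncBricks
import Literature.Computability.Complexity.ListFoldBricks
import Literature.Computability.Complexity.SplitOnesBricks
import Literature.Computability.Complexity.LengthCompare
import Literature.Computability.Complexity.PairPlumbing
import Literature.Computability.Complexity.StringEquality
import HarnessLib

/-!
# Complexity meta: the checker and the solver of Thm. 8.9 (for `UP`) are polynomial-time (Hirahara 2021)

Topic `Literature/Computability/MetaComplexity`, machine companion of `UPSearchScheme.lean` (the
scheme `UPToolkit.checker` / `UPToolkit.solver` and its correctness) and `UPSearchBricks.lean` (unary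
parameter bricks). The proof of Thm. 8.9 of S. Hirahara, *Average-case hardness of NP from
exponential worst-case hardness assumptions* (STOC 2021; ECCC TR21-058, pp. 41–42) describes the
checker `C` and the solver `S` as compositions of polynomial-time ingredients ("`S` can be implemented
as a polynomial-time algorithm, since the number of the strings `y ∈ Y_r` … is at most
`poly(n, t, 2^{k'})`"). This file builds them as `FP` string functions on the scheme encoding
`⟨x, ⟨1ᵗ, 1ᵏ⟩⟩ = schemeEnc (x, t, k)` from `FP` presentations of the ingredients, and proves the two
running-time fields of Def. 8.8 (`IsSearchUHS.solver_polyTime`, `checker_polyTime`):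

* `UPToolkit.checker_polyTimeComputable` — `C(x; 1ᵗ, 1ᵏ)` is polynomial-time, given that `sK` is
  polynomial-time on `(x, 1ᵗ)` and the estimator `Tst` is the indicator of a language `T ∈ P` on
  `⟨x, 1^{ι'}, 1^{m'}⟩`;
* `UPToolkit.solver_polyTimeComputable` — `S(x; 1ᵗ, 1ᴹ)` is polynomial-time, given moreover that
  `enum x ι k` is the list coded by `E ⟨⟨x, 1^ι⟩, 1^{p(n)+1}, 1^{2^k}, 1³⟩` for some `E ∈ FP`
  (`dpEnumEnc`; `1^{2^{k'}}` is produced by the capped doubling brick `pow2CapF` below the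
  polynomial cap `(M+1)(2t+4)^c ≥ 2^{k'}`) and `R ∈ P` (the first good candidate is extracted by the
  fold brick `Brick.foldFn`).

## References

* S. Hirahara, ECCC TR21-058, proof of Thm. 8.9: the checker `C` and the solver `S` (pp. 41–42).
* S. Arora, B. Barak, *Computational Complexity*, CUP 2009, §1.3 (closure of polynomial time).
-/

namespace Literature.Computability.MetaComplexity

open _root_.Computability Complexity Complexity.Classes Brick Plumb HashBricks Polynomial

namespace UPMachine

/-! ### Shared parameter sub-functions (on `⟨x, ⟨1ᵗ, third⟩⟩`) -/

/-- `x`. [folklore] -/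
noncomputable def xF : List Bool → List Bool := fstF
/-- `1ⁿ`. [folklore] -/
noncomputable def unF : List Bool → List Bool := onesFn ∘ fstF
/-- `1ᵗ`, normalised. [folklore] -/
noncomputable def utF : List Bool → List Bool := onesFn ∘ nthF 1
/-- the third field, normalised (`1ᵏ` for the checker, `1ᴹ` for the solver). [folklore] -/
noncomputable def u3F : List Bool → List Bool := onesFn ∘ sndPow 1

variable (a₀ c : ℕ) (τ p : Polynomial ℕ) (sKF : List Bool → List Bool)

/-- `1^{n + a₀}` (the cap of `k`). [folklore] -/
noncomputable def capKF : List Bool → List Bool := fun w => unF w ++ ones a₀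
/-- the checker's `1^{k̄}`, `k̄ = min k (n + a₀)`. [folklore] -/
noncomputable def kbarCF : List Bool → List Bool := takeFn ∘ fanoutFn (capKF a₀) u3F
/-- the solver's `1^{k̄}`, `k̄ = min (log M) (n + a₀)`. [folklore] -/
noncomputable def kbarSF : List Bool → List Bool := takeFn ∘ fanoutFn (capKF a₀) (logFn ∘ u3F)

variable (kbarF : List Bool → List Bool)

/-- `1^{k'}`, `k' = k̄ + Λ(t)`. [folklore] -/
noncomputable def kPF : List Bool → List Bool := fun w => kbarF w ++ (lamUF c ∘ utF) w
/-- `1^{s}`, `s = sK(x, t)` (from an `FP` presentation `sKF` of `sK` on `⟨x, 1ᵗ⟩`). [folklore] -/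
noncomputable def sF : List Bool → List Bool := sKF ∘ fanoutFn xF utF
/-- `1^{t'}`, `t' = τ(n + t)`. [folklore] -/
noncomputable def tPF : List Bool → List Bool := polyFn τ ∘ fun w => xF w ++ utF w
/-- `1^{ι'}`, `ι' = ⟨n, k', t', s⟩`. [folklore] -/
noncomputable def iotaF : List Bool → List Bool :=
  idx4UF ∘ fanoutFn unF (fanoutFn (kPF c kbarF) (fanoutFn (tPF τ) (sF sKF)))
/-- `1^{m'}`, `m' = (p(n)+1)k' + k'`. [folklore] -/
noncomputable def mPF : List Bool → List Bool :=
  fun w => (umulFn ∘ fanoutFn (polyFn (p + 1) ∘ unF) (kPF c kbarF)) w ++ kPF c kbarF w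
/-- the checker's query `⟨x, 1^{ι'}, 1^{m'}⟩`. [folklore] -/
noncomputable def queryCF : List Bool → List Bool :=
  fanoutFn xF (fanoutFn (iotaF c τ sKF kbarF) (mPF c p kbarF))

/-! ### Semantics of the shared sub-functions on `⟨x, ⟨1ᵗ, 1ʳ⟩⟩` -/

/-- `ones n = unaryEncodeNat n` (twin of `UPNP.ones_eq_unary` in the independent file `UPSearchNP.lean`).
[folklore] -/
theorem ones_eq_unary (n : ℕ) : ones n = unaryEncodeNat n := by
  rw [OracleCompose.unaryEncodeNat_eq_replicate]

/-- `onesFn w = ones |w|` (twin of `UPNP.onesFn_eq_ones`). [folklore] -/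
theorem onesFn_eq_ones (w : List Bool) : onesFn w = ones w.length := by
  rw [onesFn, ones_eq_unary]

/-- `|1ⁿ| = n`. [folklore] -/
@[simp] theorem length_ones' (n : ℕ) : (ones n).length = n := by simp [ones]

section Semantics

variable {a₀ c τ p sKF kbarF}
variable (x : List Bool) (t r : ℕ)

/-- The input `⟨x, ⟨1ᵗ, 1ʳ⟩⟩`. [folklore] -/
private noncomputable abbrev inp : List Bool := boolPair x (boolPair (ones t) (ones r))

/-- Value of `xF`. [folklore] -/
theorem xF_inp : xF (inp x t r) = x := by simp [xF]
/-- Value of `unF`. [folklore] -/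
theorem unF_inp : unF (inp x t r) = ones x.length := by simp [unF, onesFn_eq_ones]
/-- Value of `utF`. [folklore] -/
theorem utF_inp : utF (inp x t r) = ones t := by simp [utF, onesFn_eq_ones]
/-- Value of `u3F`. [folklore] -/
theorem u3F_inp : u3F (inp x t r) = ones r := by simp [u3F, onesFn_eq_ones]

/-- Value of the checker's `1^{k̄}`. [folklore] -/
theorem kbarCF_inp : kbarCF a₀ (inp x t r) = ones (min r (x.length + a₀)) := by
  simp only [kbarCF, capKF, Function.comp_apply, fanoutFn_apply, unF_inp, u3F_inp, takeFn_boolPair,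
    List.length_append, length_ones']
  simp [ones, Nat.min_comm]

/-- Value of the solver's `1^{k̄}`. [folklore] -/
theorem kbarSF_inp : kbarSF a₀ (inp x t r) = ones (min (Nat.log 2 r) (x.length + a₀)) := by
  simp only [kbarSF, capKF, Function.comp_apply, fanoutFn_apply, unF_inp, u3F_inp, takeFn_boolPair,
    List.length_append, length_ones', logFn, ones]
  simp [Nat.min_comm]

variable {kb : ℕ} (hkbar : kbarF (inp x t r) = ones kb)
include hkbar
/-- Value of `1^{k'}`. [folklore] -/

theorem kPF_inp : kPF c kbarF (inp x t r) = ones (kb + c * (Nat.log 2 (t + 2) + 1)) := by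
  simp only [kPF, Function.comp_apply, hkbar, utF_inp, lamUF_apply]
  simp [ones]

variable {sK : List Bool → ℕ → ℕ} (hsKF : ∀ (x : List Bool) (t : ℕ), sKF (boolPair x (ones t)) = ones (sK x t))
include hsKF
/-- Value of `1^{ι'}`. [folklore] -/

theorem iotaF_inp : iotaF c τ sKF kbarF (inp x t r) =
    ones (Nat.pair x.length (Nat.pair (kb + c * (Nat.log 2 (t + 2) + 1))
      (Nat.pair (τ.eval (x.length + t)) (sK x t)))) := by
  simp only [iotaF, sF, tPF, Function.comp_apply, fanoutFn_apply, unF_inp, kPF_inp x t r hkbar, xF_inp, utF_inp,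
    hsKF, polyFn_apply, List.length_append, length_ones', idx4UF_apply]

omit hsKF in
/-- Value of `1^{m'}`. [folklore] -/
theorem mPF_inp : mPF c p kbarF (inp x t r) =
    ones ((p.eval x.length + 1) * (kb + c * (Nat.log 2 (t + 2) + 1)) + (kb + c * (Nat.log 2 (t + 2) + 1))) := by
  simp only [mPF, Function.comp_apply, fanoutFn_apply, unF_inp, kPF_inp x t r hkbar, polyFn_apply, length_ones',
    eval_add, eval_one, umulFn_boolPair]
  simp [ones]

/-- Value of the checker's query: `schemeEnc (x, ι', m')`. [folklore] -/
theorem queryCF_inp : queryCF c τ p sKF kbarF (inp x t r) =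
    schemeEnc (x, Nat.pair x.length (Nat.pair (kb + c * (Nat.log 2 (t + 2) + 1))
      (Nat.pair (τ.eval (x.length + t)) (sK x t))),
      (p.eval x.length + 1) * (kb + c * (Nat.log 2 (t + 2) + 1)) + (kb + c * (Nat.log 2 (t + 2) + 1))) := by
  rw [queryCF, fanoutFn_apply, fanoutFn_apply, xF_inp, iotaF_inp x t r hkbar hsKF, mPF_inp x t r hkbar, schemeEnc,
    ones_eq_unary, ones_eq_unary]

end Semantics

/-! ### `FP` membership of the shared sub-functions -/

section FPness

variable {a₀ c τ p sKF kbarF}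

/-- `unF ∈ FP`. [folklore] -/
theorem unF_mem_FP : unF ∈ FP := comp_mem_FP onesFn_mem_FP fstF_mem_FP
/-- `utF ∈ FP`. [folklore] -/
theorem utF_mem_FP : utF ∈ FP := comp_mem_FP onesFn_mem_FP (nthF_mem_FP 1)
/-- `u3F ∈ FP`. [folklore] -/
theorem u3F_mem_FP : u3F ∈ FP := comp_mem_FP onesFn_mem_FP (sndPow_mem_FP 1)
/-- `capKF ∈ FP`. [folklore] -/
theorem capKF_mem_FP : capKF a₀ ∈ FP := by
  unfold capKF; exact append_mem_FP unF_mem_FP (const_mem_FP _)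
/-- `kbarCF ∈ FP`. [folklore] -/
theorem kbarCF_mem_FP : kbarCF a₀ ∈ FP := by
  unfold kbarCF; exact comp_mem_FP takeFn_mem_FP (fanoutFn_mem_FP capKF_mem_FP u3F_mem_FP)
/-- `kbarSF ∈ FP`. [folklore] -/
theorem kbarSF_mem_FP : kbarSF a₀ ∈ FP := by
  unfold kbarSF; exact comp_mem_FP takeFn_mem_FP (fanoutFn_mem_FP capKF_mem_FP (comp_mem_FP logFn_mem_FP u3F_mem_FP))

variable (hk : kbarF ∈ FP) (hs : sKF ∈ FP)
include hk
/-- `kPF ∈ FP`. [folklore] -/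

theorem kPF_mem_FP : kPF c kbarF ∈ FP := by
  unfold kPF; exact append_mem_FP hk (comp_mem_FP (lamUF_mem_FP c) utF_mem_FP)

include hs in
/-- `iotaF ∈ FP`. [folklore] -/
theorem iotaF_mem_FP : iotaF c τ sKF kbarF ∈ FP := by
  unfold iotaF sF tPF
  exact comp_mem_FP idx4UF_mem_FP (fanoutFn_mem_FP unF_mem_FP (fanoutFn_mem_FP (kPF_mem_FP hk)
    (fanoutFn_mem_FP (comp_mem_FP (polyFn_mem_FP τ) (append_mem_FP fstF_mem_FP utF_mem_FP)) (comp_mem_FP hs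
      (fanoutFn_mem_FP fstF_mem_FP utF_mem_FP)))))

/-- `mPF ∈ FP`. [folklore] -/
theorem mPF_mem_FP : mPF c p kbarF ∈ FP := by
  unfold mPF
  exact append_mem_FP (comp_mem_FP umulFn_mem_FP (fanoutFn_mem_FP (comp_mem_FP (polyFn_mem_FP (p + 1)) unF_mem_FP)
    (kPF_mem_FP hk))) (kPF_mem_FP hk)

include hs in
/-- `queryCF ∈ FP`. [folklore] -/
theorem queryCF_mem_FP : queryCF c τ p sKF kbarF ∈ FP := by
  unfold queryCF
  exact fanoutFn_mem_FP fstF_mem_FP (fanoutFn_mem_FP (iotaF_mem_FP hk hs) (mPF_mem_FP hk))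

end FPness

/-! ### The solver's extra pieces: the enumeration input and the search fold -/

variable (E rTest : List Bool → List Bool)

/-- The cap `1^{(M+1)(2t+4)^c}` (`≥ 2^{k'}`). [folklore] -/
noncomputable def capPF : List Bool → List Bool :=
  umulFn ∘ fanoutFn (List.cons true ∘ u3F) (polyFn ((2 * X + 4) ^ c) ∘ utF)
/-- `1^{2^{k'}}` by capped doubling. [folklore] -/
noncomputable def pw2F : List Bool → List Bool := pow2CapF ∘ fanoutFn (kPF c kbarF) (capPF c)
/-- The enumerator input `⟨⟨x, 1^{ι'}⟩, 1^{p(n)+1}, 1^{2^{k'}}, 1³⟩`. [folklore] -/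
noncomputable def enumInF : List Bool → List Bool :=
  fanoutFn (fanoutFn xF (iotaF c τ sKF kbarF)) (fanoutFn (polyFn (p + 1) ∘ unF) (fanoutFn (pw2F c kbarF) (fun _ => ones 3)))
/-- The candidate test `⟨x, u⟩ ↦ V(x, unpad u)` on the fold argument `⟨⟨x, L⟩, ⟨u, acc⟩⟩`. [folklore] -/
noncomputable def goodF : List Bool → List Bool :=
  andFn (lenLeFn p) rTest ∘ fanoutFn (fstF ∘ fstF) (afterZeroFn ∘ fstF ∘ sndF)
/-- The `found` flag test (one bit on every input). [folklore] -/
noncomputable def flagF : List Bool → List Bool := eqPairFn ∘ fanoutFn (fstF ∘ sndF ∘ sndF) (fun _ => [true])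
/-- One fold step: keep a found certificate, else test the current candidate. [folklore] -/
noncomputable def stepF : List Bool → List Bool :=
  iteFn flagF (sndF ∘ sndF)
    (iteFn (goodF p rTest) (fanoutFn (fun _ => [true]) (afterZeroFn ∘ fstF ∘ sndF)) (sndF ∘ sndF))
/-- **The solver as a string function.** [Hirahara 2021 (ECCC TR21-058), proof of Thm. 8.9 (the
solver `S`)] [folklore] -/
noncomputable def solverF : List Bool → List Bool :=
  sndF ∘ foldFn (stepF p rTest) (fun _ => boolPair [false] []) ∘ fanoutFn xF (E ∘ enumInF c τ p sKF kbarF)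

/-- The fold model: `(found?, result)` after scanning a list of candidates. [folklore] -/
def searchModel (good : List Bool → Bool) : Bool × List Bool → List (List Bool) → Bool × List Bool
  | acc, [] => acc
  | (true, res), _ :: _ => (true, res)
  | (false, res), u :: L => if good u then searchModel good (true, afterZeroFn u) L  -- found: but keep scanning idly
      else searchModel good (false, res) L

/-- The idle scan keeps a found result. [folklore] -/
theorem searchModel_true (good : List Bool → Bool) (res : List Bool) : ∀ L, searchModel good (true, res) L = (true, res)
  | [] => rfl
  | _ :: _ => rfl

/-- **The fold model computes the first good candidate** (unpadded; `[]` if none). [folklore] -/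
theorem searchModel_false (good : List Bool → Bool) (res : List Bool) : ∀ L : List (List Bool),
    (searchModel good (false, res) L).2 = ((L.find? good).elim res afterZeroFn)
  | [] => rfl
  | u :: L => by
    rw [searchModel, List.find?_cons]
    by_cases h : good u = true
    · rw [if_pos h, searchModel_true]
      simp [h]
    · rw [if_neg h, searchModel_false good res L]
      simp [h]

/-! ### The search fold implements the model -/

section Fold

variable {a₀ c τ p sKF kbarF E rTest} {R : Language Bool} (hr : ∀ v, rTest v = [R.boolIndicator v])

/-- The encoded accumulator `⟨[found], result⟩`. [folklore] -/
def encAcc (a : Bool × List Bool) : List Bool := boolPair [a.1] a.2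

/-- The candidate predicate of the model (`= UPToolkit.isGood R p x`). [folklore] -/
noncomputable def goodP (R : Language Bool) (p : Polynomial ℕ) (x u : List Bool) : Bool :=
  decide ((afterZeroFn u).length ≤ p.eval x.length) && R.boolIndicator (boolPair x (afterZeroFn u))

include hr in
/-- Semantics of the candidate test. [folklore] -/
theorem goodF_apply (x L u acc : List Bool) :
    goodF p rTest (boolPair (boolPair x L) (boolPair u acc)) = [goodP R p x u] := by
  simp only [goodF, goodP, Function.comp_apply, fanoutFn_apply, fstF_boolPair, sndF_boolPair]
  exact andFn_apply (lenLeFn_boolPair p x _) (hr _)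

include hr in
/-- **One fold step follows the model.** [folklore] -/
theorem stepF_apply (x L u : List Bool) (a : Bool × List Bool) :
    stepF p rTest (boolPair (boolPair x L) (boolPair u (encAcc a))) = encAcc (searchModel (goodP R p x) a [u]) := by
  obtain ⟨b, res⟩ := a
  have hflag : flagF (boolPair (boolPair x L) (boolPair u (encAcc (b, res)))) = [b] := by
    cases b <;> simp [flagF, encAcc, fanoutFn_apply, eqPairFn_boolPair]
  unfold stepF
  rw [iteFn_apply hflag]
  cases b with
  | true => simp [encAcc, searchModel]
  | false =>
    simp only [Bool.false_eq_true, ite_false]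
    rw [iteFn_apply (goodF_apply hr x L u _)]
    by_cases hg : goodP R p x u = true
    · simp [hg, encAcc, searchModel, fanoutFn_apply]
    · simp [hg, encAcc, searchModel]

include hr in
/-- **The fold follows the model** on any list of candidates. [folklore] -/
theorem foldl_stepF (x L : List Bool) : ∀ (items : List (List Bool)) (a : Bool × List Bool),
    items.foldl (fun acc u => stepF p rTest (boolPair (boolPair x L) (boolPair u acc))) (encAcc a) =
      encAcc (searchModel (goodP R p x) a items)
  | [], a => by simp [searchModel]
  | u :: items, a => by
    rw [List.foldl_cons, stepF_apply hr, foldl_stepF x L items]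
    obtain ⟨b, res⟩ := a
    cases b with
    | true => simp [searchModel, searchModel_true]
    | false =>
      simp only [searchModel]
      split_ifs <;> rfl

/-- The step is one of its branches on every input, hence of bounded growth. [folklore] -/
theorem foldGrowth_stepF (hr1 : OneBit rTest) : FoldGrowth 4 (stepF p rTest) := by
  intro v
  have hflag : OneBit (flagF : List Bool → List Bool) := fun z => by
    rcases eqPairFn_eq_or (fanoutFn (fstF ∘ sndF ∘ sndF) (fun _ => [true]) z) with h | h <;> exact ⟨_, h⟩
  have hgood : OneBit (goodF p rTest) :=
    (oneBit_andFn (fun z => by rcases lenLeFn_eq_or p z with h | h <;> exact ⟨_, h⟩) hr1).comp _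
  have hacc : (sndF (sndF v)).length ≤ (sndF (sndF v)).length + 4 * (fstF (sndF v)).length + 4 * ((fstF v).length + 1) := by
    omega
  have hnew : (fanoutFn (fun _ => [true]) (afterZeroFn ∘ fstF ∘ sndF) v).length ≤
      (sndF (sndF v)).length + 4 * (fstF (sndF v)).length + 4 * ((fstF v).length + 1) := by
    rw [fanoutFn_apply, length_boolPair]
    have := length_afterZeroFn_le (fstF (sndF v))
    simp only [Function.comp_apply, List.length_singleton]
    omega
  unfold stepF
  rw [iteFn_of_oneBit hflag]
  split_ifs
  · exact hacc
  · rw [iteFn_of_oneBit hgood]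
    split_ifs
    · exact hnew
    · exact hacc

/-- `stepF ∈ FP` for `rTest ∈ FP`. [folklore] -/
theorem stepF_mem_FP (hrF : rTest ∈ FP) : stepF p rTest ∈ FP := by
  have hflag : flagF ∈ FP := by
    unfold flagF
    exact comp_mem_FP eqPairFn_mem_FP (fanoutFn_mem_FP (comp_mem_FP fstF_mem_FP (comp_mem_FP sndF_mem_FP sndF_mem_FP))
      (const_mem_FP _))
  have hgood : goodF p rTest ∈ FP := by
    unfold goodF
    exact comp_mem_FP (andFn_mem_FP (lenLeFn_mem_FP p) hrF) (fanoutFn_mem_FP (comp_mem_FP fstF_mem_FP fstF_mem_FP)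
      (comp_mem_FP afterZeroFn_mem_FP (comp_mem_FP fstF_mem_FP sndF_mem_FP)))
  have hacc : sndF ∘ sndF ∈ FP := comp_mem_FP sndF_mem_FP sndF_mem_FP
  unfold stepF
  exact iteFn_mem_FP hflag hacc (iteFn_mem_FP hgood (fanoutFn_mem_FP (const_mem_FP _)
    (comp_mem_FP afterZeroFn_mem_FP (comp_mem_FP fstF_mem_FP sndF_mem_FP))) hacc)

include hr in
/-- **The solver string function computes the first good candidate** of the coded list
`E ⟨…⟩`. [Hirahara 2021 (ECCC TR21-058), proof of Thm. 8.9 (the solver `S`)] [folklore] -/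
theorem solverF_apply (w : List Bool) :
    solverF c τ p sKF kbarF E rTest w =
      ((decNil (E (enumInF c τ p sKF kbarF w))).find? (goodP R p (xF w))).elim [] afterZeroFn := by
  simp only [solverF, Function.comp_apply, fanoutFn_apply, foldFn_boolPair]
  rw [show boolPair [false] [] = encAcc (false, []) from rfl, foldl_stepF hr, encAcc, sndF_boolPair,
    searchModel_false]

end Fold

/-! ### The solver's parameters on `⟨x, ⟨1ᵗ, 1ᴹ⟩⟩` -/

section SolverSemantics

variable {a₀ c τ p sKF kbarF E}
variable {sK : List Bool → ℕ → ℕ} (hsKF : ∀ (x : List Bool) (t : ℕ), sKF (boolPair x (ones t)) = ones (sK x t))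
variable (x : List Bool) (t M : ℕ)

/-- The cap has length `(M+1)(2t+4)^c`. [folklore] -/
theorem capPF_inp : capPF c (boolPair x (boolPair (ones t) (ones M))) = ones ((M + 1) * (2 * t + 4) ^ c) := by
  simp only [capPF, Function.comp_apply, fanoutFn_apply, u3F_inp, utF_inp, polyFn_apply, length_ones']
  rw [show true :: ones M = ones (M + 1) by simp [ones, List.replicate_succ], umulFn_boolPair]
  simp [eval_pow]

/-- **The cap dominates `2^{k'}`**: `2^{min (log M) B + c (log (t+2) + 1)} ≤ (M+1)(2t+4)^c`. [folklore] -/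
theorem two_pow_kP_le_cap (B : ℕ) :
    2 ^ (min (Nat.log 2 M) B + c * (Nat.log 2 (t + 2) + 1)) ≤ (M + 1) * (2 * t + 4) ^ c := by
  have h1 : 2 ^ min (Nat.log 2 M) B ≤ M + 1 := by
    refine (Nat.pow_le_pow_right two_pos (min_le_left _ _)).trans ?_
    rcases Nat.eq_zero_or_pos M with rfl | hM
    · simp
    · exact (Nat.pow_log_le_self 2 hM.ne').trans (Nat.le_succ M)
  have h2 : 2 ^ (c * (Nat.log 2 (t + 2) + 1)) ≤ (2 * t + 4) ^ c := by
    rw [pow_mul']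
    refine Nat.pow_le_pow_left ?_ c
    rw [pow_succ]
    have := Nat.pow_log_le_self 2 (show t + 2 ≠ 0 by omega)
    omega
  rw [pow_add]
  exact Nat.mul_le_mul h1 h2

include hsKF in
/-- **The enumerator input is `dpEnumEnc ⟨x, 1^{ι'}⟩ (p(n)+1) k' 3`** with `k' = k̄ + Λ(t)`,
`k̄ = min (log M) (n + a₀)`. [folklore] -/
theorem enumInF_inp :
    enumInF c τ p sKF (kbarSF a₀) (boolPair x (boolPair (ones t) (ones M))) =
      dpEnumEnc (boolPair x (unaryEncodeNat (Nat.pair x.length (Nat.pair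
          (min (Nat.log 2 M) (x.length + a₀) + c * (Nat.log 2 (t + 2) + 1))
          (Nat.pair (τ.eval (x.length + t)) (sK x t))))))
        (p.eval x.length + 1) (min (Nat.log 2 M) (x.length + a₀) + c * (Nat.log 2 (t + 2) + 1)) 3 := by
  have hkbar := kbarSF_inp (a₀ := a₀) x t M
  have hpw2 : pw2F c (kbarSF a₀) (boolPair x (boolPair (ones t) (ones M))) =
      ones (2 ^ (min (Nat.log 2 M) (x.length + a₀) + c * (Nat.log 2 (t + 2) + 1))) := by
    simp only [pw2F, Function.comp_apply, fanoutFn_apply, kPF_inp x t M hkbar, capPF_inp, pow2CapF_boolPair,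
      length_ones']
    rw [min_eq_left (two_pow_kP_le_cap t M _)]
  simp only [enumInF, fanoutFn_apply, Function.comp_apply]
  rw [xF_inp, iotaF_inp x t M hkbar hsKF, unF_inp, polyFn_apply, length_ones', hpw2]
  simp only [dpEnumEnc, ← ones_eq_unary, eval_add, eval_one]

end SolverSemantics

variable {a₀ c τ p sKF kbarF E rTest}

/-- `solverF ∈ FP`. [Hirahara 2021 (ECCC TR21-058), proof of Thm. 8.9 ("`S` can be implemented as a
polynomial-time algorithm")] [folklore] -/
theorem solverF_mem_FP (hk : kbarF ∈ FP) (hs : sKF ∈ FP) (hE : E ∈ FP) (hrF : rTest ∈ FP) (hr1 : OneBit rTest) :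
    solverF c τ p sKF kbarF E rTest ∈ FP := by
  have hcap : capPF c ∈ FP := by
    unfold capPF
    exact comp_mem_FP umulFn_mem_FP (fanoutFn_mem_FP (comp_mem_FP (cons_mem_FP true) u3F_mem_FP)
      (comp_mem_FP (polyFn_mem_FP _) utF_mem_FP))
  have hpw2 : pw2F c kbarF ∈ FP := by
    unfold pw2F
    exact comp_mem_FP pow2CapF_mem_FP (fanoutFn_mem_FP (kPF_mem_FP hk) hcap)
  have hin : enumInF c τ p sKF kbarF ∈ FP := by
    unfold enumInF
    exact fanoutFn_mem_FP (fanoutFn_mem_FP fstF_mem_FP (iotaF_mem_FP hk hs)) (fanoutFn_mem_FP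
      (comp_mem_FP (polyFn_mem_FP _) unF_mem_FP) (fanoutFn_mem_FP hpw2 (const_mem_FP _)))
  unfold solverF
  exact comp_mem_FP sndF_mem_FP (comp_mem_FP (foldFn_mem_FP (stepF_mem_FP hrF) (const_mem_FP _) (foldGrowth_stepF hr1))
    (fanoutFn_mem_FP fstF_mem_FP (comp_mem_FP hE hin)))

end UPMachine

/-! ### The running-time fields of Def. 8.8 for the scheme of `UPSearchScheme.lean` -/

namespace UniversalMachine.UPToolkit

open UPMachine

variable {U : UniversalMachine} {R : Language Bool} {p : Polynomial ℕ} (K : U.UPToolkit R p)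

/-- **The checker is polynomial-time** (`IsSearchUHS.checker_polyTime`), given a polynomial-time
`sK` (on `(x, 1ᵗ)`, unary output — `KtApproximation.polyTimeComputable_ktApprox`) and an estimator
`Tst` that is the indicator of a language `T ∈ P` on `⟨x, 1^ι, 1^m⟩` (`AccProbTester.exists_accTester`).
[Hirahara 2021 (ECCC TR21-058), proof of Thm. 8.9 (the checker `C`)] [cite: Hirahara2021, Thm. 8.9 (proof)] -/
theorem checker_polyTimeComputable (c : ℕ)
    (hsK : PolyTimeComputable paramEnc unaryEncodeNat (Function.uncurry K.sK)) {T : Set (List Bool)} (hT : T ∈ P)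
    (hTst : ∀ (x : List Bool) (ι m : ℕ), K.Tst x ι m = T.boolIndicator (schemeEnc (x, ι, m))) :
    PolyTimeComputable schemeEnc encodeBool fun q : List Bool × ℕ × ℕ => K.checker c q.1 q.2.1 q.2.2 := by
  -- `sK` as a total `FP` function on `⟨x, u⟩`
  set sKF : List Bool → List Bool := fun w => unaryEncodeNat (K.sK (boolUnpair w).1 (boolUnpair w).2.length)
  have hsKF : sKF ∈ FP := mem_FP_of_unaryArg hsK
  have hsKF_apply : ∀ (x : List Bool) (t : ℕ), sKF (boolPair x (ones t)) = ones (K.sK x t) := fun x t => by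
    simp only [sKF, boolUnpair_boolPair, length_ones']
    exact (ones_eq_unary _).symm
  -- the indicator of `T`
  obtain ⟨r, M, hM⟩ := polyTimeDecidable_iff.1 (mem_P_iff_holds.1 hT)
  have hdec : (fun z : List Bool => encodeBool (T.boolIndicator z)) ∈ FP := ⟨r, M, fun z => hM z⟩
  -- the checker as a total `FP` function
  have hF : (fun z : List Bool => encodeBool (T.boolIndicator z)) ∘ queryCF c K.τ p sKF (kbarCF K.a₀) ∈ FP :=
    comp_mem_FP hdec (queryCF_mem_FP kbarCF_mem_FP hsKF)
  obtain ⟨r', M', hM'⟩ := hF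
  refine ⟨r', M', ?_⟩
  rintro ⟨x, t, k⟩
  have h := hM' (schemeEnc (x, t, k))
  have hq := queryCF_inp (c := c) (τ := K.τ) (p := p) x t k (kbarCF_inp (a₀ := K.a₀) x t k) hsKF_apply
  have hin : schemeEnc (x, t, k) = boolPair x (boolPair (ones t) (ones k)) := by
    simp only [schemeEnc, ones_eq_unary]
  have hval : ((fun z : List Bool => encodeBool (T.boolIndicator z)) ∘ queryCF c K.τ p sKF (kbarCF K.a₀))
      (schemeEnc (x, t, k)) = encodeBool (K.checker c x t k) := by
    rw [Function.comp_apply, hin, hq, ← hTst]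
    simp only [UPToolkit.checker, UPToolkit.checkerCore, UPToolkit.kCap, UPToolkit.idxP, UPToolkit.kP,
      UPToolkit.lam, UPToolkit.tP, idx4]
  rw [hval] at h
  exact h

/-- **The solver is polynomial-time** (`IsSearchUHS.solver_polyTime`), given moreover that
`enum x ι k` is the list coded by `E ⟨⟨x, 1^ι⟩, 1^{p(n)+1}, 1^{2^k}, 1³⟩` for an `E ∈ FP` (the
enumerator of Thm. 3.12 run with advantage `1/3`) and that `R ∈ P`. [Hirahara 2021 (ECCC TR21-058),
proof of Thm. 8.9 (the solver `S`: "can be implemented as a polynomial-time algorithm")]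
[cite: Hirahara2021, Thm. 8.9 (proof)] -/
theorem solver_polyTimeComputable (c : ℕ)
    (hsK : PolyTimeComputable paramEnc unaryEncodeNat (Function.uncurry K.sK)) {E : List Bool → List Bool}
    (hE : E ∈ FP)
    (hEnum : ∀ (x : List Bool) (ι k : ℕ), K.enum x ι k =
      decNil (E (dpEnumEnc (boolPair x (unaryEncodeNat ι)) (p.eval x.length + 1) k 3)))
    (hR : R ∈ P) :
    PolyTimeComputable schemeEnc (id : List Bool → List Bool) fun q : List Bool × ℕ × ℕ => K.solver c q.1 q.2.1 q.2.2 := by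
  set sKF : List Bool → List Bool := fun w => unaryEncodeNat (K.sK (boolUnpair w).1 (boolUnpair w).2.length)
  have hsKF : sKF ∈ FP := mem_FP_of_unaryArg hsK
  have hsKF_apply : ∀ (x : List Bool) (t : ℕ), sKF (boolPair x (ones t)) = ones (K.sK x t) := fun x t => by
    simp only [sKF, boolUnpair_boolPair, length_ones']
    exact (ones_eq_unary _).symm
  obtain ⟨r, M, hM⟩ := polyTimeDecidable_iff.1 (mem_P_iff_holds.1 hR)
  have hdec : (fun z : List Bool => encodeBool (R.boolIndicator z)) ∈ FP := ⟨r, M, fun z => hM z⟩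
  set rTest : List Bool → List Bool := fun z => encodeBool (R.boolIndicator z)
  have hr : ∀ v, rTest v = [R.boolIndicator v] := fun v => rfl
  have hF : solverF c K.τ p sKF (kbarSF K.a₀) E rTest ∈ FP :=
    solverF_mem_FP kbarSF_mem_FP hsKF hE hdec fun z => ⟨_, rfl⟩
  obtain ⟨r', M', hM'⟩ := hF
  refine ⟨r', M', ?_⟩
  rintro ⟨x, t, Mx⟩
  have h := hM' (schemeEnc (x, t, Mx))
  have hin : schemeEnc (x, t, Mx) = boolPair x (boolPair (ones t) (ones Mx)) := by
    simp only [schemeEnc, ones_eq_unary]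
  have hval : solverF c K.τ p sKF (kbarSF K.a₀) E rTest (schemeEnc (x, t, Mx)) = K.solver c x t Mx := by
    rw [solverF_apply hr, hin, enumInF_inp hsKF_apply, xF_inp]
    -- unfold the scheme's solver
    simp only [UPToolkit.solver, UPToolkit.solverCore, UPToolkit.kCap, UPToolkit.idxP, UPToolkit.kP, UPToolkit.lam,
      UPToolkit.tP, idx4, hEnum]
    have hgood : goodP R p x = UPToolkit.isGood R p x := by
      funext u
      rfl
    rw [hgood]
    rfl
  rw [hval] at h
  exact h

end UniversalMachine.UPToolkit


end Literature.Computability.MetaComplexity
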